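import Literature.MathematicalPhysics.QuantumFieldTheory.Balaban1983to89.B9Thm313WholeCutLettersL2From3152
import Literature.MathematicalPhysics.QuantumFieldTheory.Balaban1983to89.B9PerturbationMajorantsAtLettersPhys
import Literature.MathematicalPhysics.QuantumFieldTheory.Balaban1983to89.B9Eq346GradGpDivAtPinsL2Closed
import Literature.MathematicalPhysics.QuantumFieldTheory.Balaban1983to89.B9RWSums347DefiniteFaces
import Literature.MathematicalPhysics.QuantumFieldTheory.Balaban1983to89.B9RWSumsDefinitePins
import Literature.MathematicalPhysics.QuantumFieldTheory.Balaban1983to89.B9CoReadingCoordsTranspose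
import Literature.MathematicalPhysics.QuantumFieldTheory.Balaban1983to89.B9Thm311SymmAtRecordV4
import Literature.MathematicalPhysics.QuantumFieldTheory.Balaban1983to89.B9Thm311AdjointPairs
import Literature.MathematicalPhysics.QuantumFieldTheory.Balaban1983to89.B9Thm37GlueTorusCov
import Literature.MathematicalPhysics.QuantumFieldTheory.Balaban1983to89.B9CoReadingCoordsH
import Literature.MathematicalPhysics.QuantumFieldTheory.Balaban1983to89.B9Thm313WholeDirL2Z
import Summits.QuantumFields.YangMills.Theorems.BalabanUVNodesN06CutL2LettersAtPinsPhys
import Literature.MathematicalPhysics.QuantumFieldTheory.Balaban1983to89.B9BackgroundsKLevelV1R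

/-!
# BalabanUVNodes ∕ N06 ([B9], `Dag.B9_main`) — CASCADE-R STEP 3: THE R-GENERIC TWIN of `N06CutL2LettersAtPinsPhys.vDRDG_vGDRD_of_pins` (rows 20–21's re-cut block-`L²` letters
# `vDRDG ∕ vGDRD` from (3.152) + Theorem 3.1 ∕ (3.49) ∕ (3.46)₄), re-typed over the CLASS-PARAMETRIC member background `bg9YR 𝔸 G R₁ R₂` (objects AND premises)

Track A of `YM-PLAN.md` (cell `pub-ymgap`, D-0062), node **N06** = [Balaban1985BackgroundPropagators] Thms 3.1–3.15; seat `pub-ymgap-dag-n06-d` (gen 13).  WHY: node00-def-Y g23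
RULING-2 (I.39588), road (α1); census I.39391 marks `vDRDG_vGDRD_of_pins` «`bg9Y`-PINNED ✗, c-GENERIC» (rule (b)).  The landed text with `bg9Y … x ↦ bg9YR … R₁ R₂ x` in every
object and premise; its ONE class read («`U` is `SU(N)`-valued», `hU.1.1`, for the trace-symmetry of `G′` and the contracting transporters) taken from the displayed class axiom
`hGR : MemOfFam SU(N) R₁` (`mem_of_reg335R`); dag-n06-l's engines `vDRDG_of_ids3152 ∕ vGDRD_of_ids3152` and this seat's `letters313L2MZ_mono_const` are B-GENERIC, called VERBATIM
(the helper lemmas of the landed file are imported, not restated).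
★★ `vDRDG_vGDRD_of_pinsR` (+ `hGR`).  HONEST FRAMING.  Mechanical re-typing; `h31 h49 h46 hRco12 h152` stay HYPOTHESES; nothing of [B9] asserted; COUNT-NEUTRAL; N06 NOT discharged;
K1⁹ NOT closed; one finite 𝕋⁴ programme at fixed `ε` — NOT continuum ∕ OS ∕ mass gap ∕ Clay.  0 `def`, 0 `sorry`.
-/

noncomputable section

namespace Summit.QuantumFields.YangMills.BalabanUVNodes.N06CutL2LettersAtPinsPhysR

open Literature.MathematicalPhysics.QuantumFieldTheory.Balaban1983to89
open Literature.MathematicalPhysics.QuantumFieldTheory.Balaban1983to89.Node00 (FBondY IBondY CfgY GpY GpPhysY parSymY)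
open Literature.MathematicalPhysics.QuantumFieldTheory.Balaban1983to89.Node00.OpsYSectDCoords (DvcoKH DvscoKH RcoK isTransposePair_DvcoKH_DvscoKH isTransposePair_RcoK cR39_trBasis_pos)
open Literature.MathematicalPhysics.QuantumFieldTheory.Balaban1983to89.B9Thm34Ext (toB6)
open Literature.MathematicalPhysics.QuantumFieldTheory.Balaban1983to89.B11SectG (BlockNorm HasMaj RowSum)
open Literature.MathematicalPhysics.QuantumFieldTheory.Balaban1983to89.B9SectDL2Decay (BlockBd)
open Literature.MathematicalPhysics.QuantumFieldTheory.Balaban1983to89.B9Thm37Glue (IsTransposePair isTransposePair_one)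
open Literature.MathematicalPhysics.QuantumFieldTheory.Balaban1983to89.B9Thm37GlueTorusCov (isTransposePair_smul)
open Literature.MathematicalPhysics.QuantumFieldTheory.Balaban1983to89.B9Thm312Whole (GeoOK)
open Literature.MathematicalPhysics.QuantumFieldTheory.Balaban1983to89.B9RWSums343to347Whole (Facts347)
open Literature.MathematicalPhysics.QuantumFieldTheory.Balaban1983to89.B9RWSumsDefinitePins (PinPrims)
open Literature.MathematicalPhysics.QuantumFieldTheory.Balaban1983to89.B9RWSums347DefiniteFaces (exp261 lemma21Pack_geo9Y)
open Literature.MathematicalPhysics.QuantumFieldTheory.Balaban1983to89.B9PinMembersKLevelV1 (MemberY geo9Y bg9Y)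
open Literature.MathematicalPhysics.QuantumFieldTheory.Balaban1983to89.B9BackgroundsKLevelV1R (RegFamY bg9YR MemOfFam mem_of_reg335R)
open Summit.QuantumFields.YangMills.BalabanUVNodes.N06CutL2LettersAtPinsPhys (letters313L2MZ_mono_const)
open Literature.MathematicalPhysics.QuantumFieldTheory.Balaban1983to89.B9GeoLemma21KLevelV1 (geo9Y_len_pos geo9Y_dist_triangle geo9Y_dist_comm rowSum261_geo9Y)
open Literature.MathematicalPhysics.QuantumFieldTheory.Balaban1983to89.B9GeoNormsKLevelV1 (geo9K_dist_nonneg)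
open Literature.MathematicalPhysics.QuantumFieldTheory.Balaban1983to89.B7Prop2SpecialUnitary (specialUnitaryUnits specialUnitaryUnits_le_unitaryUnits)
open Literature.MathematicalPhysics.QuantumFieldTheory.Balaban1983to89.B9CoReadingCoords (XBK blkBK)
open Literature.MathematicalPhysics.QuantumFieldTheory.Balaban1983to89.B9CoReadingCoordsH (XHK)
open Literature.MathematicalPhysics.QuantumFieldTheory.Balaban1983to89.B9CoReadingCoordsS (XSK GcoS blkSK sIK)
open Literature.MathematicalPhysics.QuantumFieldTheory.Balaban1983to89.B9CoReadingCoordsTranspose (TrIdx trBasis isTransposePair_GcoS_trBasis)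
open Literature.MathematicalPhysics.QuantumFieldTheory.Balaban1983to89.B9Thm39ReadingCoords (cR39 cR39_nonneg)
open Literature.MathematicalPhysics.QuantumFieldTheory.Balaban1983to89.B9PerturbationMajorantAlgebra (Thm31GpMaj Proj349Maj)
open Literature.MathematicalPhysics.QuantumFieldTheory.Balaban1983to89.B9PerturbationMajorantsAtLetters (PcoK rcoK_eq)
open Literature.MathematicalPhysics.QuantumFieldTheory.Balaban1983to89.B9PerturbationMajorantsAtLettersPhys (rcoK_GpPhysY)
open Literature.MathematicalPhysics.QuantumFieldTheory.Balaban1983to89.B9Thm311AdjointPairs (GpY_isSymmTr)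
open Literature.MathematicalPhysics.QuantumFieldTheory.Balaban1983to89.B9Thm311SymmAtRecordV4 (symm0_parSymY)
open Literature.MathematicalPhysics.QuantumFieldTheory.Balaban1983to89.B9Thm313WholeRgdFrom3152 (Ids3152)
open Literature.MathematicalPhysics.QuantumFieldTheory.Balaban1983to89.B9Thm313WholeDirL2Z (Letters313L2MZ)
open Literature.MathematicalPhysics.QuantumFieldTheory.Balaban1983to89.B9Thm313WholeCutLettersL2From3152 (vDRDG_of_ids3152 vGDRD_of_ids3152)
open Literature.MathematicalPhysics.QuantumFieldTheory.Balaban1983to89.B9Eq346GradGpDivAtPinsL2Closed (B46 δ46 B46_pos)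
open Literature.MathematicalPhysics.QuantumFieldTheory.Balaban1983to89.B6GlobalChartV1 (blkV1)
open Literature.MathematicalPhysics.QuantumFieldTheory.Balaban1983to89.B6Ineq2142KLevelV1 (β lvl)
open Literature.MathematicalPhysics.QuantumFieldTheory.Balaban1983to89.B6Geom246MultiLevelTorus (geomT)
open scoped Matrix.Norms.L2Operator

variable {N : ℕ} [NeZero N]
variable {d ℓ : ℕ} {hd : 1 ≤ d + 1} {hL : Odd (ℓ + 1) ∧ 1 < ℓ + 1} {b₀ b₁ : ℝ} {Mstar : ℕ}
variable [∀ x : MemberY d ℓ hd hL b₀ b₁ Mstar, Fintype (geo9Y x).Site]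

/-- ★★ **THE RE-CUT BLOCK-`L²` LETTERS AT THE PINS, R-GENERIC** (module docstring).
[cite: Balaban1985BackgroundPropagators, (3.151)–(3.153) p.426, Thm 3.1 (3.42)∕(3.46) pp.397–398, (3.49) p.399, (3.35)–(3.36) p.396; Balaban1984PropagatorsII, (2.51)–(2.56) pp.232–233] -/
theorem vDRDG_vGDRD_of_pinsR {R₁ R₂ : RegFamY d ℓ hd hL b₀ b₁ Mstar (Matrix (Fin N) (Fin N) ℂ)} (hGR : MemOfFam (specialUnitaryUnits (Fin N)) R₁)
    (H : MemberY d ℓ hd hL b₀ b₁ Mstar → Prop)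
    (bI : ∀ x : MemberY d ℓ hd hL b₀ b₁ Mstar, FBondY x.toKIdx → IBondY x.toKIdx)
    (𝔬12 : ∀ x : MemberY d ℓ hd hL b₀ b₁ Mstar, B9Thm312Whole.Ops (geo9Y x) (bg9YR (Matrix (Fin N) (Fin N) ℂ) (specialUnitaryUnits (Fin N)) R₁ R₂ x)
      (XBK (TrIdx N) x.toKIdx) (XBK (TrIdx N) x.toKIdx) (XHK (TrIdx N) x.toKIdx) (XSK (TrIdx N) x.toKIdx))
    (hblk12 : ∀ x : MemberY d ℓ hd hL b₀ b₁ Mstar, (𝔬12 x).blk = blkBK x.toKIdx (bI x))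
    (hblkW12 : ∀ x : MemberY d ℓ hd hL b₀ b₁ Mstar, (𝔬12 x).blkW = blkSK x.toKIdx (sIK x.toKIdx (bI x)))
    (hDvco12 : ∀ (x : MemberY d ℓ hd hL b₀ b₁ Mstar) (U : (bg9YR (Matrix (Fin N) (Fin N) ℂ) (specialUnitaryUnits (Fin N)) R₁ R₂ x).Cfg),
      (𝔬12 x).Dv U = DvcoKH x.toKIdx (trBasis N) (bg9YR (Matrix (Fin N) (Fin N) ℂ) (specialUnitaryUnits (Fin N)) R₁ R₂ x) (fun U => U) U)
    (hDvsco12 : ∀ (x : MemberY d ℓ hd hL b₀ b₁ Mstar) (U : (bg9YR (Matrix (Fin N) (Fin N) ℂ) (specialUnitaryUnits (Fin N)) R₁ R₂ x).Cfg),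
      (𝔬12 x).Dvstar U = DvscoKH x.toKIdx (trBasis N) (bg9YR (Matrix (Fin N) (Fin N) ℂ) (specialUnitaryUnits (Fin N)) R₁ R₂ x) (fun U => U) U)
    (hRco12 : ∀ (x : MemberY d ℓ hd hL b₀ b₁ Mstar) (U : (bg9YR (Matrix (Fin N) (Fin N) ℂ) (specialUnitaryUnits (Fin N)) R₁ R₂ x).Cfg),
      (𝔬12 x).R U = RcoK x.toKIdx (trBasis N) (bg9YR (Matrix (Fin N) (Fin N) ℂ) (specialUnitaryUnits (Fin N)) R₁ R₂ x) (fun U => U) (parSymY x.toKIdx) (GpPhysY x.toKIdx (parSymY x.toKIdx)) U)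
    (q : PinPrims) (hq : q.OK) {c35 : ℝ} (hc35 : 0 < c35) {M₁ a₁ B31 δ31 CP δP rT σS δ₃ : ℝ} (B₄₀ : ℝ)
    (hB31 : 0 ≤ B31) (hCP : 0 ≤ CP) (hσS : 0 < σS) (hrTσ : 2 * σS ≤ rT) (hrT31 : rT ≤ δ31) (hrTP : rT ≤ δP)
    (hrT4 : rT ≤ δ46 d ℓ hd hL b₀ b₁ Mstar N c35 hc35) (hδ₃ : δ₃ ≤ (1 - 2 * q.αF) * rT - σS)
    -- Theorem 3.1 for G′ at the LATTICE letter (the certificate's `h31`, from `thm31GpMaj_of_t37_pairM`)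
    (h31 : ∀ x : MemberY d ℓ hd hL b₀ b₁ Mstar, M₁ ≤ (geo9Y x).M → ∀ α₀ : ℝ, 0 < α₀ → (geo9Y x).M * α₀ ≤ a₁ →
      ∀ U : (bg9YR (Matrix (Fin N) (Fin N) ℂ) (specialUnitaryUnits (Fin N)) R₁ R₂ x).Cfg, (bg9YR (Matrix (Fin N) (Fin N) ℂ) (specialUnitaryUnits (Fin N)) R₁ R₂ x).Reg335 c35 α₀ U →
        Thm31GpMaj (g := geo9Y x) (blkSK x.toKIdx (sIK x.toKIdx (bI x))) (blkBK x.toKIdx (bI x))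
          (GcoS x.toKIdx (trBasis N) (bg9YR (Matrix (Fin N) (Fin N) ℂ) (specialUnitaryUnits (Fin N)) R₁ R₂ x) (fun U => U) (GpY x.toKIdx (parSymY x.toKIdx)) U)
          (DvcoKH x.toKIdx (trBasis N) (bg9YR (Matrix (Fin N) (Fin N) ℂ) (specialUnitaryUnits (Fin N)) R₁ R₂ x) (fun U => U) U)
          (DvscoKH x.toKIdx (trBasis N) (bg9YR (Matrix (Fin N) (Fin N) ℂ) (specialUnitaryUnits (Fin N)) R₁ R₂ x) (fun U => U) U) 1 (H x) B31 δ31)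
    -- (3.49) for P = I − R at the lattice letter (the certificate's `h49`, from `proj349Maj_of_t37_display348_rate`)
    (h49 : ∀ x : MemberY d ℓ hd hL b₀ b₁ Mstar, M₁ ≤ (geo9Y x).M → ∀ α₀ : ℝ, 0 < α₀ → (geo9Y x).M * α₀ ≤ a₁ →
      ∀ U : (bg9YR (Matrix (Fin N) (Fin N) ℂ) (specialUnitaryUnits (Fin N)) R₁ R₂ x).Cfg, (bg9YR (Matrix (Fin N) (Fin N) ℂ) (specialUnitaryUnits (Fin N)) R₁ R₂ x).Reg335 c35 α₀ U →
        Proj349Maj (g := geo9Y x) (blkSK x.toKIdx (sIK x.toKIdx (bI x))) (blkBK x.toKIdx (bI x))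
          (PcoK x.toKIdx (trBasis N) (bg9YR (Matrix (Fin N) (Fin N) ℂ) (specialUnitaryUnits (Fin N)) R₁ R₂ x) (fun U => U) (parSymY x.toKIdx) (GpY x.toKIdx (parSymY x.toKIdx)) U)
          (DvcoKH x.toKIdx (trBasis N) (bg9YR (Matrix (Fin N) (Fin N) ℂ) (specialUnitaryUnits (Fin N)) R₁ R₂ x) (fun U => U) U)
          (DvscoKH x.toKIdx (trBasis N) (bg9YR (Matrix (Fin N) (Fin N) ℂ) (specialUnitaryUnits (Fin N)) R₁ R₂ x) (fun U => U) U) 1 (H x) CP δP)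
    -- (3.46)₄ for DG′D\* at the lattice letter, CLOSED constants (the certificate's `h46`, dag-n06-w7 `blockBd_DvGcoSDvs_memberY_at`)
    (h46 : ∀ x : MemberY d ℓ hd hL b₀ b₁ Mstar, M₁ ≤ (geo9Y x).M → ∀ α₀ : ℝ, 0 < α₀ → (geo9Y x).M * α₀ ≤ a₁ →
      ∀ U : (bg9YR (Matrix (Fin N) (Fin N) ℂ) (specialUnitaryUnits (Fin N)) R₁ R₂ x).Cfg, (bg9YR (Matrix (Fin N) (Fin N) ℂ) (specialUnitaryUnits (Fin N)) R₁ R₂ x).Reg335 c35 α₀ U →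
        BlockBd (g := toB6 (geo9Y x) 1 (H x)) (𝔬12 x).blk (𝔬12 x).blk
          (DvcoKH x.toKIdx (trBasis N) (bg9YR (Matrix (Fin N) (Fin N) ℂ) (specialUnitaryUnits (Fin N)) R₁ R₂ x) (fun U => U) U ∘ₗ
            GcoS x.toKIdx (trBasis N) (bg9YR (Matrix (Fin N) (Fin N) ℂ) (specialUnitaryUnits (Fin N)) R₁ R₂ x) (fun U => U) (GpY x.toKIdx (parSymY x.toKIdx)) U ∘ₗ
              DvscoKH x.toKIdx (trBasis N) (bg9YR (Matrix (Fin N) (Fin N) ℂ) (specialUnitaryUnits (Fin N)) R₁ R₂ x) (fun U => U) U)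
          (fun (y y' : (geo9Y x).Site) => B46 d ℓ hd hL b₀ b₁ Mstar N c35 hc35 * Real.exp (-(δ46 d ℓ hd hL b₀ b₁ Mstar N c35 hc35 * (geo9Y x).dist y y'))))
    -- the DISPLAYED identity (3.152) at the G′ model `GcoS … (GpY …)` (which CARRIES print's η²: `GcoS … O U = (etaS²·cR39 b) • coordOpK …` — node00-def-Y LOCATED-152)
    (h152 : ∀ x : MemberY d ℓ hd hL b₀ b₁ Mstar, M₁ ≤ (geo9Y x).M → ∀ α₀ : ℝ, 0 < α₀ → (geo9Y x).M * α₀ ≤ a₁ →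
      ∀ U : (bg9YR (Matrix (Fin N) (Fin N) ℂ) (specialUnitaryUnits (Fin N)) R₁ R₂ x).Cfg, (bg9YR (Matrix (Fin N) (Fin N) ℂ) (specialUnitaryUnits (Fin N)) R₁ R₂ x).Reg335 c35 α₀ U →
        (bg9YR (Matrix (Fin N) (Fin N) ℂ) (specialUnitaryUnits (Fin N)) R₁ R₂ x).Reg336 c35 α₀ U →
          Ids3152 (𝔬12 x) (fun U => GcoS x.toKIdx (trBasis N) (bg9YR (Matrix (Fin N) (Fin N) ℂ) (specialUnitaryUnits (Fin N)) R₁ R₂ x) (fun U => U) (GpY x.toKIdx (parSymY x.toKIdx)) U) U) :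
    ∃ (Mc B₄ : ℝ), M₁ ≤ Mc ∧ B₄₀ ≤ B₄ ∧
      ∀ x : MemberY d ℓ hd hL b₀ b₁ Mstar, Mc ≤ (geo9Y x).M → ∀ α₀ : ℝ, 0 < α₀ → (geo9Y x).M * α₀ ≤ a₁ →
        ∀ U : (bg9YR (Matrix (Fin N) (Fin N) ℂ) (specialUnitaryUnits (Fin N)) R₁ R₂ x).Cfg, (bg9YR (Matrix (Fin N) (Fin N) ℂ) (specialUnitaryUnits (Fin N)) R₁ R₂ x).Reg335 c35 α₀ U →
          (bg9YR (Matrix (Fin N) (Fin N) ℂ) (specialUnitaryUnits (Fin N)) R₁ R₂ x).Reg336 c35 α₀ U →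
            BlockBd (g := toB6 (geo9Y x) 1 (H x)) (𝔬12 x).blk (𝔬12 x).blk ((𝔬12 x).Dv U ∘ₗ (𝔬12 x).R U ∘ₗ (𝔬12 x).Dvstar U ∘ₗ (𝔬12 x).G1 U)
                (fun (y y' : (geo9Y x).Site) => B₄ * (((geo9Y x).len y)⁻¹ * (geo9Y x).len y') * Real.exp (-(δ₃ * (geo9Y x).dist y y'))) ∧
              BlockBd (g := toB6 (geo9Y x) 1 (H x)) (𝔬12 x).blk (𝔬12 x).blk ((𝔬12 x).G1 U ∘ₗ (𝔬12 x).Dv U ∘ₗ (𝔬12 x).R U ∘ₗ (𝔬12 x).Dvstar U)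
                (fun (y y' : (geo9Y x).Site) => B₄ * ((geo9Y x).len y * ((geo9Y x).len y')⁻¹) * Real.exp (-(δ₃ * (geo9Y x).dist y y'))) := by
  have hN0 : 0 < N := Nat.pos_of_ne_zero (NeZero.ne N)
  have hc0 : 0 < cR39 (trBasis N) := cR39_trBasis_pos hN0
  have hϱ : 0 ≤ (cR39 (trBasis N))⁻¹ := inv_nonneg.mpr hc0.le
  have hrT0 : 0 < rT := by linarith only [hσS, hrTσ]
  have h2α : 0 < 1 - 2 * q.α := by linarith only [hq.α_lt]
  -- the member facts at the rate rT (exponent α := q.α inside `exp261`, transfer exponent α_F) and [4] (2.61) at the rate σS, above ONE threshold each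
  obtain ⟨Mth, -, hfacts, -⟩ := lemma21Pack_geo9Y (d := d) (ℓ := ℓ) (hd := hd) (hL := hL) (b₀ := b₀) (b₁ := b₁) (Mstar := Mstar) H hq.α_pos hq.α_lt
    (div_pos hrT0 h2α) hq.αF_pos (by linarith only [hq.αF_lt])
  have hrate : (1 - 2 * q.α) * (rT / (1 - 2 * q.α)) = rT := mul_div_cancel₀ rT h2α.ne'
  obtain ⟨ML, c₁, hrow⟩ := rowSum261_geo9Y (d := d) (ℓ := ℓ) (hd := hd) (hL := hL) (b₀ := b₀) (b₁ := b₁) (Mstar := Mstar) σS hσS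
  set c : ℝ := max c₁ 0 with hcdef
  have hc : 0 ≤ c := le_max_right _ _
  set L₀ : ℝ := ((ℓ + 1 : ℕ) : ℝ) with hL₀
  have hBD : 0 ≤ B46 d ℓ hd hL b₀ b₁ Mstar N c35 hc35 := (B46_pos d ℓ hd hL b₀ b₁ Mstar N c35 hc35).le
  set B₄ : ℝ := max B₄₀ ((cR39 (trBasis N))⁻¹ * L₀ * (B46 d ℓ hd hL b₀ b₁ Mstar N c35 hc35 + CP * L₀ * B31 * c)) with hB₄def
  have hL₀0 : 0 ≤ L₀ := by rw [hL₀]; positivity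
  have hB₄b : (cR39 (trBasis N))⁻¹ * L₀ * (B46 d ℓ hd hL b₀ b₁ Mstar N c35 hc35 + CP * L₀ * B31 * c) ≤ B₄ := le_max_right _ _
  -- the rate bookkeeping of `vDRDG_of_ids3152` at (δ := rT, α := q.αF, σ := σS)
  have hαδ : 0 ≤ q.αF * rT := mul_nonneg hq.αF_pos.le hrT0.le
  have hαF2 : q.αF * rT ≤ rT / 2 := by have := hq.αF_lt; nlinarith [hrT0.le, this]
  have hbud : 0 ≤ rT - σS - q.αF * rT := by linarith only [hrTσ, hαF2, hrT0.le]
  have hδD : rT - σS - q.αF * rT ≤ δ46 d ℓ hd hL b₀ b₁ Mstar N c35 hc35 := by linarith only [hrT4, hσS.le, hαδ]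
  have hδ₄ : δ₃ ≤ rT - σS - 2 * (q.αF * rT) := by linarith only [hδ₃]
  refine ⟨max M₁ (max Mth ML), B₄, le_max_left _ _, le_max_left _ _, fun x hM α₀ hα ha U hU hU' => ?_⟩
  have hM1x : M₁ ≤ (geo9Y x).M := (le_max_left _ _).trans hM
  have hMthx : Mth ≤ (geo9Y x).M := ((le_max_left _ _).trans (le_max_right _ _)).trans hM
  have hMLx : ML ≤ (geo9Y x).M := ((le_max_right _ _).trans (le_max_right _ _)).trans hM
  have hG : GeoOK (geo9Y x) := ⟨geo9Y_dist_triangle x, geo9Y_dist_comm x, geo9K_dist_nonneg x.toKIdx, geo9Y_len_pos x⟩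
  have hF := hfacts x hMthx
  rw [hrate] at hF
  have hrowx : RowSum (toB6 (geo9Y x) 1 (H x)) σS c := fun y => (hrow x hMLx y).trans (le_max_left _ _)
  have hUu : ∀ μ z, ((U μ z : (Matrix (Fin N) (Fin N) ℂ)ˣ) : Matrix (Fin N) (Fin N) ℂ) ∈ unitary (Matrix (Fin N) (Fin N) ℂ) :=
    fun μ z => specialUnitaryUnits_le_unitaryUnits ((mem_of_reg335R hGR x hU) μ z)
  -- Theorem 3.1 read for (𝔬12 x)'s block maps and divergence letters (NO units transfer: `GcoS` carries η², def-Y LOCATED-152)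
  have h31p : Thm31GpMaj (g := geo9Y x) (𝔬12 x).blkW (𝔬12 x).blk (GcoS x.toKIdx (trBasis N) (bg9YR (Matrix (Fin N) (Fin N) ℂ) (specialUnitaryUnits (Fin N)) R₁ R₂ x) (fun U => U) (GpY x.toKIdx (parSymY x.toKIdx)) U) ((𝔬12 x).Dv U) ((𝔬12 x).Dvstar U) 1 (H x) B31 δ31 := by
    rw [hblkW12 x, hblk12 x, hDvco12 x U, hDvsco12 x U]; exact h31 x hM1x α₀ hα ha U hU
  -- (3.49) read for (𝔬12 x)'s letters
  have h49p : Proj349Maj (g := geo9Y x) (𝔬12 x).blkW (𝔬12 x).blk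
      (PcoK x.toKIdx (trBasis N) (bg9YR (Matrix (Fin N) (Fin N) ℂ) (specialUnitaryUnits (Fin N)) R₁ R₂ x) (fun U => U) (parSymY x.toKIdx) (GpY x.toKIdx (parSymY x.toKIdx)) U)
      ((𝔬12 x).Dv U) ((𝔬12 x).Dvstar U) 1 (H x) CP δP := by
    rw [hblkW12 x, hblk12 x, hDvco12 x U, hDvsco12 x U]; exact h49 x hM1x α₀ hα ha U hU
  -- (3.46)₄ read for (𝔬12 x)'s divergence letters
  have h46p : BlockBd (g := toB6 (geo9Y x) 1 (H x)) (𝔬12 x).blk (𝔬12 x).blk ((𝔬12 x).Dv U ∘ₗ GcoS x.toKIdx (trBasis N) (bg9YR (Matrix (Fin N) (Fin N) ℂ) (specialUnitaryUnits (Fin N)) R₁ R₂ x) (fun U => U) (GpY x.toKIdx (parSymY x.toKIdx)) U ∘ₗ (𝔬12 x).Dvstar U)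
      (fun (y y' : (geo9Y x).Site) => B46 d ℓ hd hL b₀ b₁ Mstar N c35 hc35 * Real.exp (-(δ46 d ℓ hd hL b₀ b₁ Mstar N c35 hc35 * (geo9Y x).dist y y'))) := by
    rw [hDvco12 x U, hDvsco12 x U]; exact h46 x hM1x α₀ hα ha U hU
  -- R = ϱ(I − P) at the models (R is degree-0 homogeneous in G′: `rcoK_GpPhysY`)
  have hR : (𝔬12 x).R U = (cR39 (trBasis N))⁻¹ • (LinearMap.id -
      PcoK x.toKIdx (trBasis N) (bg9YR (Matrix (Fin N) (Fin N) ℂ) (specialUnitaryUnits (Fin N)) R₁ R₂ x) (fun U => U) (parSymY x.toKIdx) (GpY x.toKIdx (parSymY x.toKIdx)) U) := by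
    rw [hRco12 x U, rcoK_GpPhysY, rcoK_eq]
  -- the transposition letters
  have hGsym := isTransposePair_GcoS_trBasis x.toKIdx (bg9YR (Matrix (Fin N) (Fin N) ℂ) (specialUnitaryUnits (Fin N)) R₁ R₂ x) (fun U => U)
    (GpY x.toKIdx (parSymY x.toKIdx)) U (GpY_isSymmTr x.toKIdx (parSymY x.toKIdx) U (symm0_parSymY x.toKIdx specialUnitaryUnits_le_unitaryUnits (mem_of_reg335R hGR x hU)))
  have hGpT : IsTransposePair (GcoS x.toKIdx (trBasis N) (bg9YR (Matrix (Fin N) (Fin N) ℂ) (specialUnitaryUnits (Fin N)) R₁ R₂ x) (fun U => U) (GpY x.toKIdx (parSymY x.toKIdx)) U) (GcoS x.toKIdx (trBasis N) (bg9YR (Matrix (Fin N) (Fin N) ℂ) (specialUnitaryUnits (Fin N)) R₁ R₂ x) (fun U => U) (GpY x.toKIdx (parSymY x.toKIdx)) U) := hGsym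
  have hDvT : IsTransposePair ((𝔬12 x).Dv U) ((𝔬12 x).Dvstar U) := by
    rw [hDvco12 x U, hDvsco12 x U]
    exact isTransposePair_DvcoKH_DvscoKH x.toKIdx (bg9YR (Matrix (Fin N) (Fin N) ℂ) (specialUnitaryUnits (Fin N)) R₁ R₂ x) (fun U => U) U hUu
  have hRsym := isTransposePair_RcoK x.toKIdx (bg9YR (Matrix (Fin N) (Fin N) ℂ) (specialUnitaryUnits (Fin N)) R₁ R₂ x) (fun U => U) U
    specialUnitaryUnits_le_unitaryUnits (mem_of_reg335R hGR x hU)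
  have hPeq : PcoK x.toKIdx (trBasis N) (bg9YR (Matrix (Fin N) (Fin N) ℂ) (specialUnitaryUnits (Fin N)) R₁ R₂ x) (fun U => U) (parSymY x.toKIdx)
      (GpY x.toKIdx (parSymY x.toKIdx)) U = 1 - (cR39 (trBasis N)) •
        RcoK x.toKIdx (trBasis N) (bg9YR (Matrix (Fin N) (Fin N) ℂ) (specialUnitaryUnits (Fin N)) R₁ R₂ x) (fun U => U) (parSymY x.toKIdx) (GpY x.toKIdx (parSymY x.toKIdx)) U := by
    rw [rcoK_eq, smul_smul, mul_inv_cancel₀ hc0.ne', one_smul, Module.End.one_eq_id, sub_sub_cancel]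
  have hPT : IsTransposePair
      (PcoK x.toKIdx (trBasis N) (bg9YR (Matrix (Fin N) (Fin N) ℂ) (specialUnitaryUnits (Fin N)) R₁ R₂ x) (fun U => U) (parSymY x.toKIdx) (GpY x.toKIdx (parSymY x.toKIdx)) U)
      (PcoK x.toKIdx (trBasis N) (bg9YR (Matrix (Fin N) (Fin N) ℂ) (specialUnitaryUnits (Fin N)) R₁ R₂ x) (fun U => U) (parSymY x.toKIdx) (GpY x.toKIdx (parSymY x.toKIdx)) U) := by
    rw [hPeq]; exact isTransposePair_one.sub (isTransposePair_smul hRsym _)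
  have hI := h152 x hM1x α₀ hα ha U hU hU'
  exact ⟨vDRDG_of_ids3152 (P := fun U => PcoK x.toKIdx (trBasis N) (bg9YR (Matrix (Fin N) (Fin N) ℂ) (specialUnitaryUnits (Fin N)) R₁ R₂ x) (fun U => U) (parSymY x.toKIdx)
        (GpY x.toKIdx (parSymY x.toKIdx)) U) hG hF hrowx h31p h49p h46p hR hI hGpT hDvT hPT hϱ hB31 hCP hBD hc hσS.le hαδ hrT31 hrTP hbud hδD
        hB₄b hδ₄,
      vGDRD_of_ids3152 (P := fun U => PcoK x.toKIdx (trBasis N) (bg9YR (Matrix (Fin N) (Fin N) ℂ) (specialUnitaryUnits (Fin N)) R₁ R₂ x) (fun U => U) (parSymY x.toKIdx)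
        (GpY x.toKIdx (parSymY x.toKIdx)) U) hG hF hrowx h31p h49p h46p hR hI hGpT hDvT hPT hϱ hB31 hCP hBD hc hσS.le hαδ hrT31 hrTP hbud hδD
        hB₄b hδ₄⟩

end Summit.QuantumFields.YangMills.BalabanUVNodes.N06CutL2LettersAtPinsPhysR

end
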